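import Mathlib.GroupTheory.Perm.Cycle.Type
import Literature.RepresentationTheory.FiniteGroups.IsotypicProjector
import Literature.RepresentationTheory.FiniteGroups.UnitaryWedderburn
import Literature.NumberTheory.DiophantineGeometry.SymmetricGroupRepsCompletenessProofs
import HarnessLib

/-!
# Isotypic projectors of the symmetric group are indexed by partitions

Topic `Literature/RepresentationTheory/FiniteGroups`. For `G = 𝔖ₙ = Equiv.Perm (Fin n)` the
irreducible complex characters are exactly the Specht characters `χ^μ`, `μ ⊢ n`
(`Literature.NumberTheory.DiophantineGeometry.spechtCharacter ℂ μ`, with the tree's discharged facts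
`isIrreducible_spechtRep_holds`, `nonempty_equiv_iff_holds`,
`exists_equiv_spechtRep_of_isIrreducible_holds`), so the isotypic projectors of
`IsotypicProjector.lean` of any finite-dimensional complex representation `ρ` of `𝔖ₙ` form the
family `P_μ = isotypicProj ρ χ^μ`, `μ ⊢ n`, with `P_μ² = P_μ`, `P_μ P_ν = 0` (`μ ≠ ν`) and
`∑_{μ ⊢ n} P_μ = 1`. PROVED here:

* `isIrrChar_spechtCharacter`, `spechtCharacter_injective`, `irrChars_perm_eq`
  (`irrChars 𝔖ₙ = {χ^μ | μ ⊢ n}`);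
* `sum_isotypicProj_specht` (`∑_{μ ⊢ n} P_μ = 1`), `isotypicProj_specht_comp_self`,
  `isotypicProj_specht_comp_of_ne`;
* `spechtCharacter_inv` (`χ^μ(σ⁻¹) = χ^μ(σ)`, as `σ⁻¹` and `σ` have the same cycle type) and, for
  every complex character of a finite group, `star_character_apply` (`χ(t)⋆ = χ(t⁻¹)`, by Weyl's
  unitarian trick, `exists_conj_unitary` of `UnitaryWedderburn.lean`); hence
  `star_spechtCharacter` (the Specht characters are real).

These are the projectors `P_λ` of Christandl–Vrana–Zuiddam (J. Amer. Math. Soc. 36 (2023), §3.1,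
"Let `P_λ^V ∈ End(V^{⊗n})` be the equivariant projection onto the subspace isomorphic to
`S_λ(V) ⊗ [λ]`") once `ρ` is the permutation action of `𝔖ₙ` on a tensor power; that
specialisation (the word model) is done separately.

## References

* J.-P. Serre, *Linear Representations of Finite Groups*, GTM 42 (1977), §2.6 Thm. 8, §1.3.
  [SerreLinearRepresentations1977]
* W. Fulton, J. Harris, *Representation Theory*, GTM 129 (1991), Thm. 4.3 (the `V_λ = ℂ𝔖_d c_λ`
  are all the irreducible representations of `𝔖_d`). [FultonHarrisGTM129]

## Mathlib and tree

Mathlib: `Equiv.Perm.isConj_iff_cycleType_eq`, `Equiv.Perm.cycleType_inv`,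
`Representation.char_conj`, `char_iso`, `LinearMap.toMatrixAlgEquiv`, `Matrix.trace_conjTranspose`,
`Matrix.trace_units_conj`, `Fintype (Nat.Partition n)`. Tree: `isotypicProj` and its API
(`IsotypicProjector.lean`); `spechtRep`, `spechtCharacter` (`SymmetricGroupReps.lean`) and the
three discharged facts above; `exists_conj_unitary` (`UnitaryWedderburn.lean`);
`Representation.nonempty_equiv_of_character_eq` (`EquivOfCharacter.lean`).
-/

noncomputable section

open scoped BigOperators Matrix
open Module
open Literature.NumberTheory.DiophantineGeometry (spechtRep spechtIdeal spechtCharacter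
  isIrreducible_spechtRep_holds nonempty_equiv_iff_holds
  exists_equiv_spechtRep_of_isIrreducible_holds spechtCharacter_conj)

namespace Literature.RepresentationTheory.FiniteGroups

/-! ### `χ(t⁻¹) = χ(t)⋆` for complex characters of finite groups -/

section StarChar

variable {G : Type} [Group G] [Finite G] {V : Type*} [AddCommGroup V] [Module ℂ V]
  [FiniteDimensional ℂ V]

/-- **Complex characters of finite groups satisfy `χ(t⁻¹) = χ(t)⋆`** (Serre §2.1 Prop. 1 (ii):
"`χ(s⁻¹) = χ(s)*`", proved there from the eigenvalues being roots of unity; here by Weyl's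
unitarian trick: in a basis making `ρ` unitary, `ρ(t⁻¹) = ρ(t)ᴴ`).
[cite: SerreLinearRepresentations1977, §2.1 Prop. 1] -/
theorem star_character_apply (ρ : Representation ℂ G V) (t : G) :
    star (ρ.character t) = ρ.character t⁻¹ := by
  classical
  set b := Module.finBasis ℂ V
  -- the matrix form of `ρ`
  set R : G →* Matrix (Fin (finrank ℂ V)) (Fin (finrank ℂ V)) ℂ :=
    ((LinearMap.toMatrixAlgEquiv b).toAlgHom.toRingHom.toMonoidHom).comp ρ with hR
  have hchar : ∀ s : G, ρ.character s = (R s).trace := fun s => by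
    rw [Representation.character, LinearMap.trace_eq_matrix_trace ℂ b]
    rfl
  obtain ⟨u, hu⟩ := exists_conj_unitary R
  -- `M s = u R(s) u⁻¹` is a unitary matrix representation
  let M : G →* Matrix (Fin (finrank ℂ V)) (Fin (finrank ℂ V)) ℂ :=
    { toFun := fun s => (u : Matrix _ _ ℂ) * R s * ((u⁻¹ : (Matrix _ _ ℂ)ˣ) : Matrix _ _ ℂ)
      map_one' := by simp
      map_mul' := fun a c => by
        simp only [map_mul, Matrix.mul_assoc, Units.inv_mul_cancel_left] }
  have hM : ∀ s, M s = (u : Matrix _ _ ℂ) * R s * ((u⁻¹ : (Matrix _ _ ℂ)ˣ) : Matrix _ _ ℂ) :=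
    fun s => rfl
  have htrM : ∀ s, (M s).trace = (R s).trace := fun s => by
    rw [hM, Matrix.trace_units_conj]
  have h1 : (M t)ᴴ * M t = 1 := by rw [hM]; exact hu t
  have hMmul : M t⁻¹ * M t = 1 := by rw [← map_mul, inv_mul_cancel, map_one]
  have hMinv : M t⁻¹ = (M t)ᴴ := by
    -- both are left inverses of `M t`
    calc M t⁻¹ = M t⁻¹ * (M t * (M t)ᴴ) := by
          rw [mul_eq_one_comm.1 h1, Matrix.mul_one]
      _ = (M t⁻¹ * M t) * (M t)ᴴ := by rw [Matrix.mul_assoc]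
      _ = (M t)ᴴ := by rw [hMmul, Matrix.one_mul]
  rw [hchar, hchar, ← htrM, ← htrM, hMinv, Matrix.trace_conjTranspose]

end StarChar

/-! ### The irreducible characters of `𝔖ₙ` -/

section Specht

variable {n : ℕ}

/-- The Specht characters are irreducible characters of `𝔖ₙ` (`isIrreducible_spechtRep_holds`).
[cite: FultonHarrisGTM129, Theorem 4.3] -/
theorem isIrrChar_spechtCharacter (μ : Nat.Partition n) :
    IsIrrChar (Equiv.Perm (Fin n)) (spechtCharacter ℂ μ) :=
  ⟨spechtIdeal ℂ μ, _, _, inferInstance, spechtRep ℂ μ, isIrreducible_spechtRep_holds μ, rfl⟩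

/-- Distinct partitions have distinct Specht characters (`nonempty_equiv_iff_holds` with the
character criterion for equivalence). [cite: FultonHarrisGTM129, Theorem 4.3] -/
theorem spechtCharacter_injective :
    Function.Injective fun μ : Nat.Partition n => spechtCharacter ℂ μ := by
  intro lam μ h
  have hne : Nonempty ((spechtRep ℂ lam).Equiv (spechtRep ℂ μ)) :=
    Representation.nonempty_equiv_of_character_eq _ _ h
  exact nonempty_equiv_iff_holds.1 hne

/-- **The irreducible characters of `𝔖ₙ` are the Specht characters** (`χ^μ`, `μ ⊢ n`;
completeness is `exists_equiv_spechtRep_of_isIrreducible_holds`).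
[cite: FultonHarrisGTM129, Theorem 4.3] -/
theorem irrChars_perm_eq :
    irrChars (Equiv.Perm (Fin n)) = Set.range fun μ : Nat.Partition n => spechtCharacter ℂ μ := by
  ext χ
  constructor
  · rintro ⟨V, _, _, _, ρ, hρ, rfl⟩
    haveI := hρ
    obtain ⟨μ, ⟨e⟩⟩ := exists_equiv_spechtRep_of_isIrreducible_holds ℂ ρ
    exact ⟨μ, (Representation.char_iso e).symm⟩
  · rintro ⟨μ, rfl⟩
    exact isIrrChar_spechtCharacter μ

/-- The finite set of irreducible characters of `𝔖ₙ` is the image of the partitions. [folklore] -/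
theorem irrChars_toFinset_perm_eq [DecidableEq (Equiv.Perm (Fin n) → ℂ)] :
    (irrChars_finite_holds (Equiv.Perm (Fin n))).toFinset =
      Finset.univ.image fun μ : Nat.Partition n => spechtCharacter ℂ μ := by
  ext χ
  rw [Set.Finite.mem_toFinset, Finset.mem_image, irrChars_perm_eq, Set.mem_range]
  simp

variable {V : Type} [AddCommGroup V] [Module ℂ V] [FiniteDimensional ℂ V]

/-- **`∑_{μ ⊢ n} P_μ = 1`**: the isotypic projectors of `𝔖ₙ` indexed by partitions sum to the
identity on every finite-dimensional complex representation (Serre §2.6 Thm. 8 for `𝔖ₙ`).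
[cite: SerreLinearRepresentations1977, §2.6 Thm. 8] -/
theorem sum_isotypicProj_specht (ρ : Representation ℂ (Equiv.Perm (Fin n)) V) :
    ∑ μ : Nat.Partition n, isotypicProj ρ (spechtCharacter ℂ μ) = LinearMap.id := by
  classical
  rw [← sum_isotypicProj ρ, irrChars_toFinset_perm_eq,
    Finset.sum_image fun μ _ ν _ h => spechtCharacter_injective h]

/-- Pointwise form of `sum_isotypicProj_specht`.
[cite: SerreLinearRepresentations1977, §2.6 Thm. 8] -/
theorem sum_isotypicProj_specht_apply (ρ : Representation ℂ (Equiv.Perm (Fin n)) V) (v : V) :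
    ∑ μ : Nat.Partition n, isotypicProj ρ (spechtCharacter ℂ μ) v = v := by
  have h := LinearMap.congr_fun (sum_isotypicProj_specht ρ) v
  rwa [LinearMap.coe_sum, Finset.sum_apply] at h

/-- `P_μ² = P_μ`. [cite: SerreLinearRepresentations1977, §2.6 Thm. 8] -/
theorem isotypicProj_specht_comp_self (ρ : Representation ℂ (Equiv.Perm (Fin n)) V)
    (μ : Nat.Partition n) :
    isotypicProj ρ (spechtCharacter ℂ μ) ∘ₗ isotypicProj ρ (spechtCharacter ℂ μ) =
      isotypicProj ρ (spechtCharacter ℂ μ) :=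
  isotypicProj_comp_self ρ (isIrrChar_spechtCharacter μ)

/-- `P_μ P_ν = 0` for `μ ≠ ν`. [cite: SerreLinearRepresentations1977, §2.6 Thm. 8] -/
theorem isotypicProj_specht_comp_of_ne (ρ : Representation ℂ (Equiv.Perm (Fin n)) V)
    {μ ν : Nat.Partition n} (h : μ ≠ ν) :
    isotypicProj ρ (spechtCharacter ℂ μ) ∘ₗ isotypicProj ρ (spechtCharacter ℂ ν) = 0 :=
  isotypicProj_comp_of_ne ρ (isIrrChar_spechtCharacter μ) (isIrrChar_spechtCharacter ν)
    fun e => h (spechtCharacter_injective e)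

omit [FiniteDimensional ℂ V] in
/-- `P_μ` commutes with the action of `𝔖ₙ`. [cite: SerreLinearRepresentations1977, §2.6 Thm. 8] -/
theorem isotypicProj_specht_comm (ρ : Representation ℂ (Equiv.Perm (Fin n)) V) (μ : Nat.Partition n)
    (σ : Equiv.Perm (Fin n)) :
    isotypicProj ρ (spechtCharacter ℂ μ) ∘ₗ ρ σ = ρ σ ∘ₗ isotypicProj ρ (spechtCharacter ℂ μ) :=
  isotypicProj_comm ρ (isIrrChar_spechtCharacter μ).isCharacter.isClassFun σ

/-- **`χ^μ(σ⁻¹) = χ^μ(σ)`**: a permutation and its inverse have the same cycle type, hence are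
conjugate, and characters are class functions. [folklore] -/
theorem spechtCharacter_inv (μ : Nat.Partition n) (σ : Equiv.Perm (Fin n)) :
    spechtCharacter ℂ μ σ⁻¹ = spechtCharacter ℂ μ σ := by
  have hconj : IsConj σ σ⁻¹ :=
    Equiv.Perm.isConj_iff_cycleType_eq.2 (Equiv.Perm.cycleType_inv σ).symm
  obtain ⟨c, hc⟩ := isConj_iff.1 hconj
  rw [← hc, spechtCharacter_conj]

/-- **The Specht characters are real**: `(χ^μ(σ))⋆ = χ^μ(σ)` (`χ(σ)⋆ = χ(σ⁻¹) = χ(σ)`).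
[folklore] -/
theorem star_spechtCharacter (μ : Nat.Partition n) (σ : Equiv.Perm (Fin n)) :
    star (spechtCharacter ℂ μ σ) = spechtCharacter ℂ μ σ :=
  (star_character_apply (spechtRep ℂ μ) σ).trans (spechtCharacter_inv μ σ)

end Specht

end Literature.RepresentationTheory.FiniteGroups

end
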